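import Summits.QuantumFields.YangMills.Theorems.UnitScaleTiltHalvingHStokesRowOfCombDefectS
import Summits.QuantumFields.YangMills.Theorems.UnitScaleTiltHalvingHStokesRowLevelData
import Summits.QuantumFields.YangMills.Theorems.UnitScaleTiltHalvingEffGaugeRowGS
import Summits.QuantumFields.YangMills.Theorems.UnitScaleTiltHalvingDbarStairRowsOfGuards
import Summits.QuantumFields.YangMills.Theorems.UnitScaleTiltHalvingOmegaRowMemberS
import Summits.QuantumFields.YangMills.Theorems.UnitScaleTiltHalvingCombTorusPlaquettes
import HarnessLib

/-!
# Line H (`BirthV10.stub_halvingStep`, stmt-QuantumFields-19200) — ★★★ THE MEMBER-LEVEL (b)-ROW `hStokes_holds` (σ-edition): the B-al-3 door with ALL FOUR rows discharged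
# by name — comb `U1`-valuedness, LEMMA B-al-2 (comb vs torus double bar), the comb plaquettes (R-P), and the effective-gauge row (B-al-4) over the stair∕ω∕level-data rows

Cell `ym3-torus` (HUMAN RULING D-0037: YM₃ on T³ is ladder rung R3 — NOT d = 4, NOT infinite volume, NOT a mass gap, NOT the Clay problem), width seat `ym3-torus-px15` gen 4
(LEAD-H ★w5-19200 g7 WORD 22 «member-level (b)-row knit `hStokes_holds` → px15», WORD 23 «v10 = ONE closure theorem `hStokesL_holds` (px20 g5) over px15's knit», WORD 24
«σ-EDITION: the chart guard `c′ ≤ cσ` (= `2·L·c⋆` at the closure); (σ6) door σ + member knit → px15»).  `--supports stmt-QuantumFields-19200 --as helper`; THEOREMS ONLY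
(0 `def`, 0 `sorry`); count-neutral; this is binder (b) of the (M2′) assembly AT ONE MEMBER∕DATUM under displayed SCALAR windows — NOT the closure `hStokesL_holds`, NOT
`H42topCrossT`, NOT the stub, NOT the crux.

WHAT.  ★★★ `hStokes_holds` = ✓`HalvingHStokesRowOfCombDefectS.hStokes_of_rows_σ` (conclusion: the σ-assembly's binder (b) VERBATIM after `cσ := 2·((F.P K).L·c⋆)`) with
* `hCU` := px3 g5's ✓`HalvingCombTorusTower.avgIter_mem_U1` (the comb average is `SU(2) ⊂ U1`-valued);
* `hcmp` := ✓`HalvingCombTorusTowerOfStep.comb_eq_dbar_mul_defect_inAx` — LEMMA B-al-2 at the member, `ρk := R = 240·(C₂ d + 40000(d+2)²)·((2dL+1)(d(L−1)+L))²·ε₀²`;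
* `hP` := px3 g5's ✓`HalvingCombTorusPlaquettes.plaqSmall_avgIter_of_levels` over the per-level B-al-2 rows, `p := 3ε₁ + 44R`;
* `hG` := ym-ust-20520-w4 g11's ✓`HalvingEffGaugeRowGS.hG_of_rows_σ` with its rows: (F-h)∕(F-hU) := w3 g11's ✓`HalvingDbarStairRowsOfGuards.stairSizes_of_guards_inAx` ∕
  ✓`stairUnitary_of_guards_inAx_sq`, (F-ω) := px9 g6's ✓`HalvingOmegaRowMemberS.omegaRow_of_guards_σ` (chart bound `cσ`), and the eight numeric rows (`hh ω` in their `if`-letters,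
  the level sequence `E`, `θG := 3b`) := ✓`HalvingHStokesRowLevelData.levelData` over ym-ust-20520-w3 g10's ✓`HalvingEffGaugeLevelSeq` ∕ px10 g4's ✓`HalvingBalLevelRecursion`.
DISPLAYED (all scalar, all but `hA` monotone in `ε₀`∕`s`∕`cσ`∕`αω`; `hA` is L-only, true for odd `L ≥ 3`): the (R-P) datum `V ε₁ hU hV hε7 hδw hRw hσw`, B-al-2's `hα3 hα2 hw1 hw2 hA`,
the stairs' `hpw hs0 hsw hθw`, the ω-row's `hαω hαω3 hαω4 hαωexp`, `0 ≤ cσ`, the level-data windows `hhs64 hws600 hwin hsmall`, and the door's `hρk1 hθb` at `ρk := R`,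
`p := 3ε₁ + 44R`, `θG := 3·(23040·h⋆·w⋆ + 4800·w⋆²)` (`h⋆ = 4ℓ(d(L−1)·4ε₀ + (102∕100)R)`, `w⋆` = the oscillation form at `(d(L−1)·(256(d+1)(d+4)·2ε₀ + cσ), 64d·cσ)`).
HONEST SCOPE.  A knit by name over landed files; every analytic statement lives in the cited suppliers.

References: T. Bałaban, CMP **98** (1985) 17–51 [Balaban1985Averaging] ((42)–(43) pp.23–24, (84)–(85) pp.30–31, (89) p.31, (92) p.31, (99) p.32, (110) p.34, (127) p.36,
Prop. 4 (134)–(135) pp.38–39, (139)–(144) pp.39–40); CMP **99** (1985) 75–102 [Balaban1985RegularSpaces] ((1.7) p.77, (1.29) p.81, (1.42) p.83); CMP **109** (1987) 249–301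
[Balaban1987RG1] ((0.4) p.253).
-/

set_option autoImplicit false

noncomputable section

open scoped BigOperators Matrix.Norms.L2Operator
open NormedSpace
open Complex (I)

namespace Summit.QuantumFields.YangMills.Theorems.HalvingHStokesRow

open Literature.MathematicalPhysics.QuantumFieldTheory.Balaban1983to89
open Literature.MathematicalPhysics.QuantumFieldTheory.Balaban1983to89.T3ContinuumYM3Torus
open Literature.MathematicalPhysics.QuantumFieldTheory.Balaban1983to89.T3PrintedRegularMinimiser (regFibrePr)
open B5Eq118OneStroke (iterBlockOf)
open B7Prop1Explicit (e U1)
open B7Prop1Explicit renaming Site → LSite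
open B7Prop2Explicit (unitaryUnits C0 c2' avgIter)
open B7Prop4Flat (C2 c4 C1_pos)
open B7Prop1Local (InBox loK bondHiK)
open B7Eq92Concrete (mgauge)
open B7Eq84Concrete (uavg)
open B8Ineq130 (tlo thi)
open B8Ineq132 (covDerivFwd InAk)
open B8Eq119TwistedAxial (Restr129 InAx)
open B8Eq131Cubes (cube gs tLo tHi)
open B8Eq131CubesAdmissible (cubeFam)
open B8CubeMemberZd (cubeLamS)
open B8Eq184Proof (gaugeExp cfgExp)
open B8Eq140Level (SideTouches)
open B8Eq138LandauZd (IsLandau138W)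
open B8LambdaSpaceKLevel (wt)
open B8Lemma1NonAbelian (lowPart)
open B9SupplySockB9P3ZdGamma (cubeLamBP')
open B10Eq27TorusAxialLog (rel pull unitsField toUField suIncl gaugeActT axialT)
open B15Eq112TorusCover (lift cover)
open Node00 (coverAt)
open Summit.QuantumFields.YangMills.Theorems.Prop8ChartDoubleBar (dbarIterU vframeU)
open Summit.QuantumFields.YangMills.Theorems.Prop7AxialReprPrint (pull_toUField_mem pdev_pull_lt)
open HalvingHStokesRowOfCombDefectS (hStokes_of_rows_σ)
open HalvingHStokesRowLevelData (levelData)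
open HalvingEffGaugeRowGS (hG_of_rows_σ)
open HalvingDbarStairRowsOfGuards (stairSizes_of_guards_inAx stairUnitary_of_guards_inAx_sq)
open HalvingOmegaRowMemberS (omegaRow_of_guards_σ)
open HalvingCombTorusTower (avgIter_mem_U1)
open HalvingCombTorusTowerOfStep (comb_eq_dbar_mul_defect_inAx comb_eq_dbar_mul_defect_levels_inAx)
open HalvingCombTorusPlaquettes (plaqSmall_avgIter_of_levels)

variable (F : T3Family) {n K : ℕ}

set_option maxHeartbeats 400000 in
/-- ★★★ **THE (b)-ROW AT THE MEMBER** (σ-edition): the B-al-3 door with all four rows discharged by name; conclusion = the (M2′) σ-assembly's binder (b) VERBATIM (after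
`cσ := 2·((F.P K).L·c⋆)`); displayed: scalar windows only. [cite: Balaban1985Averaging, (42)-(43) pp.23-24, (84)-(85) pp.30-31, (89) p.31, (127) p.36, Prop. 4 (134)-(135) pp.38-39, (139)-(144) pp.39-40; Balaban1985RegularSpaces, (1.7) p.77, (1.29) p.81, (1.42) p.83; Balaban1987RG1, (0.4) p.253] -/
theorem hStokes_holds (hnK : n < K) (x₀ : Site (F.P K) 0) {a : LSite (F.P K).d} {M' ρ' : ℕ} (hM' : 1 ≤ M')
    (ha : ∀ ν, a ν ≤ ((iterBlockOf (K - n) x₀ ν).val : ℤ) ∧ ((iterBlockOf (K - n) x₀ ν).val : ℤ) ≤ a ν + M' - 1)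
    (hroomW : 2 * ((F.P K).L ^ (K - n) * (M' + 1) + ρ' * gs (F.P K).L (K - n)) ≤ (F.P K).sitesPerDir 0)
    (U : GaugeField (F.P K) 0 (Matrix.specialUnitaryGroup (Fin 2) ℂ))
    {ε₀ s α₄ θb ε₁ αω : ℝ} (cσ : ℝ) (hε₀ : 0 < ε₀) (hcσ0 : 0 ≤ cσ)
    -- the member's fibre datum for (R-P) (px3 g5 ✓`plaqSmall_avgIter_of_levels`)
    (V : GaugeField (F.P n) 0 (Matrix.specialUnitaryGroup (Fin 2) ℂ)) (hU : U ∈ regFibrePr F n K hnK.le ε₀ V) (hε₁ : 0 ≤ ε₁) (hε₁1 : ε₁ ≤ 1) (hV : PlaqSmall ε₁ V)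
    (hε7 : 10 ^ 7 * (F.L : ℝ) ^ 3 * ε₀ ≤ 1)
    (hδw : (((2 * ((F.P K).d * (F.P K).L) + 1) * ((F.P K).d * ((F.P K).L - 1) + (F.P K).L) : ℕ) : ℝ) * (4 * ε₀) ≤ 1 / 200)
    (hRw : (240 * (C2 (F.P K).d + 40000 * (((F.P K).d : ℝ) + 2) ^ 2) *
        (((2 * ((F.P K).d * (F.P K).L) + 1) * ((F.P K).d * ((F.P K).L - 1) + (F.P K).L) : ℕ) : ℝ) ^ 2 * ε₀ ^ 2) ≤ 1 / 200)
    (hσw : 600 * ((((F.P K).d + 2) * (F.P K).L : ℕ) : ℝ) * ((((2 * ((F.P K).d * (F.P K).L) + 1) * ((F.P K).d * ((F.P K).L - 1) + (F.P K).L) : ℕ) : ℝ) * (4 * ε₀) +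
      102 / 100 * (240 * (C2 (F.P K).d + 40000 * (((F.P K).d : ℝ) + 2) ^ 2) *
        (((2 * ((F.P K).d * (F.P K).L) + 1) * ((F.P K).d * ((F.P K).L - 1) + (F.P K).L) : ℕ) : ℝ) ^ 2 * ε₀ ^ 2)) ≤ 1)
    -- LEMMA B-al-2's scalar windows (✓`comb_eq_dbar_mul_defect[_levels]_inAx`)
    (hα3 : C0 (F.P K).d * (2 * ε₀) ≤ 1 / 3) (hα2 : 2 * (2 * ε₀) ≤ c2' (F.P K).d (F.P K).L)
    (hw1 : 10 ^ 4 * ((((F.P K).d + 2) * (F.P K).L : ℕ) : ℝ) *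
      ((((2 * ((F.P K).d * (F.P K).L) + 1) * ((F.P K).d * ((F.P K).L - 1) + (F.P K).L) : ℕ) : ℝ) * (4 * ε₀) +
        2 * (240 * (C2 (F.P K).d + 40000 * (((F.P K).d : ℝ) + 2) ^ 2) *
        (((2 * ((F.P K).d * (F.P K).L) + 1) * ((F.P K).d * ((F.P K).L - 1) + (F.P K).L) : ℕ) : ℝ) ^ 2 * ε₀ ^ 2)) ≤ 1)
    (hw2 : ((F.P K).L : ℝ) * (2 * ((((2 * ((F.P K).d * (F.P K).L) + 1) * ((F.P K).d * ((F.P K).L - 1) + (F.P K).L) : ℕ) : ℝ) * (4 * ε₀))) ≤ c4 (F.P K).d)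
    (hA : 33 * (2 * (((((F.P K).d + 2) * (F.P K).L : ℕ) : ℝ) + (F.P K).L + 2 * (((F.P K).d * (((F.P K).L - 1) / 2) : ℕ) : ℝ))) ≤ 20 * ((F.P K).L : ℝ) ^ 4)
    -- the stair rows' windows (w3 g11 ✓`stairSizes_of_guards_inAx` ∕ ✓`stairUnitary_of_guards_inAx_sq`)
    (hpw : ((((F.P K).d * ((F.P K).L - 1) : ℕ) : ℝ)) * (4 * ε₀) ≤ 1 / 200) (hs0 : 0 ≤ s) (hsw : s ≤ 1 / 200)
    (hθw : 12 * ((((F.P K).d + 2) * (F.P K).L : ℕ) : ℝ) * (s + 102 / 100 * (240 * (C2 (F.P K).d + 40000 * (((F.P K).d : ℝ) + 2) ^ 2) *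
        (((2 * ((F.P K).d * (F.P K).L) + 1) * ((F.P K).d * ((F.P K).L - 1) + (F.P K).L) : ℕ) : ℝ) ^ 2 * ε₀ ^ 2)) ≤ 1)
    -- the ω-row's windows (px9 g6 ✓`omegaRow_of_guards_σ`: Prop. 2 at the radius `αω`)
    (hαω : 0 < αω) (hαω3 : C0 (F.P K).d * αω ≤ 1 / 3) (hαω4 : 4 * αω ≤ c2' (F.P K).d (F.P K).L)
    (hαωexp : Real.exp (4 * (800 * (((F.P K).d : ℝ) + 1) ^ 2 * (((F.P K).d : ℝ) + 4)) * αω) ≤ 11 / 10)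
    -- the level-data windows (✓`HalvingHStokesRowLevelData.levelData`: `64h⋆ ≤ 1`, `600w⋆ ≤ 1`, `160(3b) + 9900w⋆ + 16128h⋆ ≤ 1`, `3b ≤ 1∕200` at chart bound `cσ`)
    (hhs64 : 64 * (4 * ((((F.P K).d + 2) * (F.P K).L : ℕ) : ℝ) * (((((F.P K).d * ((F.P K).L - 1) : ℕ) : ℝ)) * (4 * ε₀) + 102 / 100 * (240 * (C2 (F.P K).d + 40000 * (((F.P K).d : ℝ) + 2) ^ 2) * (((2 * ((F.P K).d * (F.P K).L) + 1) * ((F.P K).d * ((F.P K).L - 1) + (F.P K).L) : ℕ) : ℝ) ^ 2 * ε₀ ^ 2))) ≤ 1)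
    (hws600 : 600 * ((((F.P K).d : ℝ) * (((F.P K).L : ℝ) - 1)) * (256 * (((F.P K).d : ℝ) + 1) * (((F.P K).d : ℝ) + 4) * (2 * ε₀) + cσ) + 2 * (64 * ((F.P K).d : ℝ) * cσ) +
      (64 * ((F.P K).d : ℝ) * cσ) ^ 2 + (2 * (64 * ((F.P K).d : ℝ) * cσ) + (64 * ((F.P K).d : ℝ) * cσ) ^ 2) *
        ((((F.P K).d : ℝ) * (((F.P K).L : ℝ) - 1)) * (256 * (((F.P K).d : ℝ) + 1) * (((F.P K).d : ℝ) + 4) * (2 * ε₀) + cσ))) ≤ 1)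
    (hwin : 160 * (3 * (23040 * (4 * ((((F.P K).d + 2) * (F.P K).L : ℕ) : ℝ) * (((((F.P K).d * ((F.P K).L - 1) : ℕ) : ℝ)) * (4 * ε₀) + 102 / 100 * (240 * (C2 (F.P K).d + 40000 * (((F.P K).d : ℝ) + 2) ^ 2) * (((2 * ((F.P K).d * (F.P K).L) + 1) * ((F.P K).d * ((F.P K).L - 1) + (F.P K).L) : ℕ) : ℝ) ^ 2 * ε₀ ^ 2))) *
      ((((F.P K).d : ℝ) * (((F.P K).L : ℝ) - 1)) * (256 * (((F.P K).d : ℝ) + 1) * (((F.P K).d : ℝ) + 4) * (2 * ε₀) + cσ) + 2 * (64 * ((F.P K).d : ℝ) * cσ) +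
      (64 * ((F.P K).d : ℝ) * cσ) ^ 2 + (2 * (64 * ((F.P K).d : ℝ) * cσ) + (64 * ((F.P K).d : ℝ) * cσ) ^ 2) *
        ((((F.P K).d : ℝ) * (((F.P K).L : ℝ) - 1)) * (256 * (((F.P K).d : ℝ) + 1) * (((F.P K).d : ℝ) + 4) * (2 * ε₀) + cσ))) +
      4800 * ((((F.P K).d : ℝ) * (((F.P K).L : ℝ) - 1)) * (256 * (((F.P K).d : ℝ) + 1) * (((F.P K).d : ℝ) + 4) * (2 * ε₀) + cσ) + 2 * (64 * ((F.P K).d : ℝ) * cσ) +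
      (64 * ((F.P K).d : ℝ) * cσ) ^ 2 + (2 * (64 * ((F.P K).d : ℝ) * cσ) + (64 * ((F.P K).d : ℝ) * cσ) ^ 2) *
        ((((F.P K).d : ℝ) * (((F.P K).L : ℝ) - 1)) * (256 * (((F.P K).d : ℝ) + 1) * (((F.P K).d : ℝ) + 4) * (2 * ε₀) + cσ))) ^ 2)) +
      9900 * ((((F.P K).d : ℝ) * (((F.P K).L : ℝ) - 1)) * (256 * (((F.P K).d : ℝ) + 1) * (((F.P K).d : ℝ) + 4) * (2 * ε₀) + cσ) + 2 * (64 * ((F.P K).d : ℝ) * cσ) +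
      (64 * ((F.P K).d : ℝ) * cσ) ^ 2 + (2 * (64 * ((F.P K).d : ℝ) * cσ) + (64 * ((F.P K).d : ℝ) * cσ) ^ 2) *
        ((((F.P K).d : ℝ) * (((F.P K).L : ℝ) - 1)) * (256 * (((F.P K).d : ℝ) + 1) * (((F.P K).d : ℝ) + 4) * (2 * ε₀) + cσ))) +
      16128 * (4 * ((((F.P K).d + 2) * (F.P K).L : ℕ) : ℝ) * (((((F.P K).d * ((F.P K).L - 1) : ℕ) : ℝ)) * (4 * ε₀) + 102 / 100 * (240 * (C2 (F.P K).d + 40000 * (((F.P K).d : ℝ) + 2) ^ 2) * (((2 * ((F.P K).d * (F.P K).L) + 1) * ((F.P K).d * ((F.P K).L - 1) + (F.P K).L) : ℕ) : ℝ) ^ 2 * ε₀ ^ 2))) ≤ 1)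
    (hsmall : (3 * (23040 * (4 * ((((F.P K).d + 2) * (F.P K).L : ℕ) : ℝ) * (((((F.P K).d * ((F.P K).L - 1) : ℕ) : ℝ)) * (4 * ε₀) + 102 / 100 * (240 * (C2 (F.P K).d + 40000 * (((F.P K).d : ℝ) + 2) ^ 2) * (((2 * ((F.P K).d * (F.P K).L) + 1) * ((F.P K).d * ((F.P K).L - 1) + (F.P K).L) : ℕ) : ℝ) ^ 2 * ε₀ ^ 2))) *
      ((((F.P K).d : ℝ) * (((F.P K).L : ℝ) - 1)) * (256 * (((F.P K).d : ℝ) + 1) * (((F.P K).d : ℝ) + 4) * (2 * ε₀) + cσ) + 2 * (64 * ((F.P K).d : ℝ) * cσ) +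
      (64 * ((F.P K).d : ℝ) * cσ) ^ 2 + (2 * (64 * ((F.P K).d : ℝ) * cσ) + (64 * ((F.P K).d : ℝ) * cσ) ^ 2) *
        ((((F.P K).d : ℝ) * (((F.P K).L : ℝ) - 1)) * (256 * (((F.P K).d : ℝ) + 1) * (((F.P K).d : ℝ) + 4) * (2 * ε₀) + cσ))) +
      4800 * ((((F.P K).d : ℝ) * (((F.P K).L : ℝ) - 1)) * (256 * (((F.P K).d : ℝ) + 1) * (((F.P K).d : ℝ) + 4) * (2 * ε₀) + cσ) + 2 * (64 * ((F.P K).d : ℝ) * cσ) +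
      (64 * ((F.P K).d : ℝ) * cσ) ^ 2 + (2 * (64 * ((F.P K).d : ℝ) * cσ) + (64 * ((F.P K).d : ℝ) * cσ) ^ 2) *
        ((((F.P K).d : ℝ) * (((F.P K).L : ℝ) - 1)) * (256 * (((F.P K).d : ℝ) + 1) * (((F.P K).d : ℝ) + 4) * (2 * ε₀) + cσ))) ^ 2)) ≤ 1 / 200)
    -- the door's numeric rows at `ρk := R`, `p := 3ε₁ + 44R`, `θG := 3b`
    (hρk1 : ((F.P K).d : ℝ) * (M' + ρ') * (240 * (C2 (F.P K).d + 40000 * (((F.P K).d : ℝ) + 2) ^ 2) *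
        (((2 * ((F.P K).d * (F.P K).L) + 1) * ((F.P K).d * ((F.P K).L - 1) + (F.P K).L) : ℕ) : ℝ) ^ 2 * ε₀ ^ 2) ≤ 1 / 8)
    (hθb : 2 * (((F.P K).d : ℝ) * (M' + ρ') * ((F.P K).d * ((M' : ℝ) - 1 + 4 * ρ') * (3 * ε₁ + 44 * (240 * (C2 (F.P K).d + 40000 * (((F.P K).d : ℝ) + 2) ^ 2) *
        (((2 * ((F.P K).d * (F.P K).L) + 1) * ((F.P K).d * ((F.P K).L - 1) + (F.P K).L) : ℕ) : ℝ) ^ 2 * ε₀ ^ 2)) + 4 * (240 * (C2 (F.P K).d + 40000 * (((F.P K).d : ℝ) + 2) ^ 2) *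
        (((2 * ((F.P K).d * (F.P K).L) + 1) * ((F.P K).d * ((F.P K).L - 1) + (F.P K).L) : ℕ) : ℝ) ^ 2 * ε₀ ^ 2))) +
      3 * (3 * (23040 * (4 * ((((F.P K).d + 2) * (F.P K).L : ℕ) : ℝ) * (((((F.P K).d * ((F.P K).L - 1) : ℕ) : ℝ)) * (4 * ε₀) + 102 / 100 * (240 * (C2 (F.P K).d + 40000 * (((F.P K).d : ℝ) + 2) ^ 2) * (((2 * ((F.P K).d * (F.P K).L) + 1) * ((F.P K).d * ((F.P K).L - 1) + (F.P K).L) : ℕ) : ℝ) ^ 2 * ε₀ ^ 2))) *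
      ((((F.P K).d : ℝ) * (((F.P K).L : ℝ) - 1)) * (256 * (((F.P K).d : ℝ) + 1) * (((F.P K).d : ℝ) + 4) * (2 * ε₀) + cσ) + 2 * (64 * ((F.P K).d : ℝ) * cσ) +
      (64 * ((F.P K).d : ℝ) * cσ) ^ 2 + (2 * (64 * ((F.P K).d : ℝ) * cσ) + (64 * ((F.P K).d : ℝ) * cσ) ^ 2) *
        ((((F.P K).d : ℝ) * (((F.P K).L : ℝ) - 1)) * (256 * (((F.P K).d : ℝ) + 1) * (((F.P K).d : ℝ) + 4) * (2 * ε₀) + cσ))) +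
      4800 * ((((F.P K).d : ℝ) * (((F.P K).L : ℝ) - 1)) * (256 * (((F.P K).d : ℝ) + 1) * (((F.P K).d : ℝ) + 4) * (2 * ε₀) + cσ) + 2 * (64 * ((F.P K).d : ℝ) * cσ) +
      (64 * ((F.P K).d : ℝ) * cσ) ^ 2 + (2 * (64 * ((F.P K).d : ℝ) * cσ) + (64 * ((F.P K).d : ℝ) * cσ) ^ 2) *
        ((((F.P K).d : ℝ) * (((F.P K).L : ℝ) - 1)) * (256 * (((F.P K).d : ℝ) + 1) * (((F.P K).d : ℝ) + 4) * (2 * ε₀) + cσ))) ^ 2)) ≤ θb) :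
        ∀ (gJ : GaugeTransf (F.P K) 0 (Matrix.specialUnitaryGroup (Fin 2) ℂ)) (u₁ : LSite (F.P K).d → (Matrix (Fin 2) (Fin 2) ℂ)ˣ)
        (W : LSite (F.P K).d → Fin (F.P K).d → (Matrix (Fin 2) (Fin 2) ℂ)ˣ) (A : LSite (F.P K).d → Fin (F.P K).d → Matrix (Fin 2) (Fin 2) ℂ) (c₁ c' : ℝ)
        (κf : (Site (F.P K) 0 → Matrix (Fin 2) (Fin 2) ℂ) → (i : ℕ) → GaugeTransf (F.P K) i (Matrix (Fin 2) (Fin 2) ℂ)ˣ) (lam : LSite (F.P K).d → Matrix (Fin 2) (Fin 2) ℂ),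
      InAk (F.P K).L (K - n) (((F.L : ℝ)⁻¹) ^ (K - n)) ε₀ (fun _ => (Set.univ : Set (LSite (F.P K).d))) (pull (unitsField (toUField (GaugeField.gaugeAct gJ U))) 0) →
      (∀ m', m' ≤ K - n → ∀ Λ : ℕ → Set (LSite (F.P K).d), InAx (F.P K).L m' Λ (1 : LSite (F.P K).d → Fin (F.P K).d → (Matrix (Fin 2) (Fin 2) ℂ)ˣ) (pull (unitsField (toUField (GaugeField.gaugeAct gJ U))) 0)) →
      (∀ m', m' ≤ K - n → ∀ (x : LSite (F.P K).d) (ν : Fin (F.P K).d), tlo (F.P K).L (tLo a ρ') m' ≤ x → x + e ν ≤ thi (F.P K).L (tHi a M' ρ') m' →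
        ‖((avgIter (F.P K).L (pull (unitsField (toUField (GaugeField.gaugeAct gJ U))) 0) (K - n - m') x ν : (Matrix (Fin 2) (Fin 2) ℂ)ˣ) : Matrix (Fin 2) (Fin 2) ℂ) - 1‖ < s) →
      (∀ (x : LSite (F.P K).d) (ν : Fin (F.P K).d), tLo a ρ' ≤ x → x + e ν ≤ tHi a M' ρ' → lowPart ν (x - tLo a ρ') = 0 →
        avgIter (F.P K).L (pull (unitsField (toUField (GaugeField.gaugeAct gJ U))) 0) (K - n) x ν = 1) →
      (∀ z, ((u₁ z : (Matrix (Fin 2) (Fin 2) ℂ)ˣ) : Matrix (Fin 2) (Fin 2) ℂ) ∈ Matrix.specialUnitaryGroup (Fin 2) ℂ) →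
      mgauge (1 : LSite (F.P K).d → Fin (F.P K).d → (Matrix (Fin 2) (Fin 2) ℂ)ˣ) u₁ W = pull (unitsField (toUField (GaugeField.gaugeAct gJ U))) 0 →
      0 ≤ c' → 8 * 3800 * ((((F.P K).d + 2) * (F.P K).L : ℕ) : ℝ) ^ 2 * c' ≤ 1 → c' ≤ cσ → Real.exp c₁ - 1 ≤ ((F.L : ℝ)⁻¹) ^ (K - n) * c' →
      (∀ z ∈ cube (F.P K).L a M' ρ' (K - n) (K - n), ∀ ν : Fin (F.P K).d, W z ν = cfgExp (((F.L : ℝ)⁻¹) ^ (K - n)) A z ν ∧ ((F.L : ℝ)⁻¹) ^ (K - n) * ‖A z ν‖ ≤ c₁) →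
      (∀ (m : Site (F.P K) 0 → Matrix (Fin 2) (Fin 2) ℂ) (i : ℕ) (y : Site (F.P K) (i + 1)), κf m (i + 1) y = (vframeU (gaugeActT (κf m i) (dbarIterU i (gaugeActT
          (fun s => (u₁ (lift (F.P K) x₀ + rel x₀ s))⁻¹ * Unitary.toUnits (suIncl (gJ s)) : GaugeTransf (F.P K) 0 (Matrix (Fin 2) (Fin 2) ℂ)ˣ)
          (unitsField (toUField U))))) y)⁻¹ * κf m i (emb y) * vframeU (dbarIterU i (gaugeActT
            (fun s => (u₁ (lift (F.P K) x₀ + rel x₀ s))⁻¹ * Unitary.toUnits (suIncl (gJ s)) : GaugeTransf (F.P K) 0 (Matrix (Fin 2) (Fin 2) ℂ)ˣ) (unitsField (toUField U)))) y) →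
      (∀ (m : Site (F.P K) 0 → Matrix (Fin 2) (Fin 2) ℂ) (x : Site (F.P K) 0), ((κf m 0 x : (Matrix (Fin 2) (Fin 2) ℂ)ˣ) : Matrix (Fin 2) (Fin 2) ℂ) = exp (m x)) →
      (∀ x, IsSelfAdjoint (lam x)) → (∀ x, (lam x).trace = 0) → (∀ yc ∈ cubeLamS (F.P K).L a M' ρ' (K - n) (K - n) (K - n),
        κf (((-I) • lam) ∘ fun s : Site (F.P K) 0 => lift (F.P K) x₀ + rel x₀ s) (K - n) (coverAt (F.P K) (K - n) yc) = axialT (dbarIterU (K - n) (gaugeActT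
            (fun s => (u₁ (lift (F.P K) x₀ + rel x₀ s))⁻¹ * Unitary.toUnits (suIncl (gJ s)) : GaugeTransf (F.P K) 0 (Matrix (Fin 2) (Fin 2) ℂ)ˣ)
            (unitsField (toUField U)))) (iterBlockOf (K - n) x₀) (coverAt (F.P K) (K - n) yc)) →
      (∀ j, j ≤ K - n → ∀ b ∈ {b : LSite (F.P K).d × Fin (F.P K).d | SideTouches ((cubeFam false (F.P K).L a M' ρ' (K - n)) j) b.1 b.2},
        ‖lam b.1‖ ≤ α₄ ∧ wt (F.P K).L (((F.L : ℝ)⁻¹) ^ (K - n)) j * ‖covDerivFwd (((F.L : ℝ)⁻¹) ^ (K - n)) (1 : LSite (F.P K).d → Fin (F.P K).d → (Matrix (Fin 2) (Fin 2) ℂ)ˣ) b.2 lam b.1‖ ≤ α₄) →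
      Restr129 (F.P K).L (K - n) (cubeLamS (F.P K).L a M' ρ' (K - n) (K - n)) (1 : LSite (F.P K).d → Fin (F.P K).d → (Matrix (Fin 2) (Fin 2) ℂ)ˣ) u₁ →
      Restr129 (F.P K).L (K - n) (Function.update (cubeLamS (F.P K).L a M' ρ' (K - n) (K - n)) (K - n) ∅) (1 : LSite (F.P K).d → Fin (F.P K).d → (Matrix (Fin 2) (Fin 2) ℂ)ˣ) (u₁ * gaugeExp lam) →
      ∀ yc ∈ cubeLamS (F.P K).L a M' ρ' (K - n) (K - n) (K - n),
        ‖((axialT (dbarIterU (K - n) (gaugeActT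
            (fun s => (u₁ (lift (F.P K) x₀ + rel x₀ s))⁻¹ * Unitary.toUnits (suIncl (gJ s)) : GaugeTransf (F.P K) 0 (Matrix (Fin 2) (Fin 2) ℂ)ˣ)
            (unitsField (toUField U)))) (iterBlockOf (K - n) x₀) (coverAt (F.P K) (K - n) yc) : (Matrix (Fin 2) (Fin 2) ℂ)ˣ) : Matrix (Fin 2) (Fin 2) ℂ) - 1‖ ≤ θb := by
  obtain ⟨hh0, hh1, hω0, hω1, E, hE0, hE1, hE, hEk⟩ := levelData F (cm := cσ) hε₀.le hcσ0 hhs64 hws600 hwin hsmall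
  have hR0 : 0 ≤ (240 * (C2 (F.P K).d + 40000 * (((F.P K).d : ℝ) + 2) ^ 2) * (((2 * ((F.P K).d * (F.P K).L) + 1) * ((F.P K).d * ((F.P K).L - 1) + (F.P K).L) : ℕ) : ℝ) ^ 2 * ε₀ ^ 2) := by
    have := C1_pos (F.P K).d; unfold C2; positivity
  have hb0 : 0 ≤ (3 * (23040 * (4 * ((((F.P K).d + 2) * (F.P K).L : ℕ) : ℝ) * (((((F.P K).d * ((F.P K).L - 1) : ℕ) : ℝ)) * (4 * ε₀) + 102 / 100 * (240 * (C2 (F.P K).d + 40000 * (((F.P K).d : ℝ) + 2) ^ 2) * (((2 * ((F.P K).d * (F.P K).L) + 1) * ((F.P K).d * ((F.P K).L - 1) + (F.P K).L) : ℕ) : ℝ) ^ 2 * ε₀ ^ 2))) * ((((F.P K).d : ℝ) * (((F.P K).L : ℝ) - 1)) * (256 * (((F.P K).d : ℝ) + 1) * (((F.P K).d : ℝ) + 4) * (2 * ε₀) + cσ) + 2 * (64 * ((F.P K).d : ℝ) * cσ) + (64 * ((F.P K).d : ℝ) * cσ) ^ 2 + (2 * (64 * ((F.P K).d : ℝ)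 * cσ) + (64 * ((F.P K).d : ℝ) * cσ) ^ 2) *   ((((F.P K).d : ℝ) * (((F.P K).L : ℝ) - 1)) * (256 * (((F.P K).d : ℝ) + 1) * (((F.P K).d : ℝ) + 4) * (2 * ε₀) + cσ))) + 4800 * ((((F.P K).d : ℝ) * (((F.P K).L : ℝ) - 1)) * (256 * (((F.P K).d : ℝ) + 1) * (((F.P K).d : ℝ) + 4) * (2 * ε₀) + cσ) + 2 * (64 * ((F.P K).d : ℝ) * cσ) + (64 * ((F.P K).d : ℝ) * cσ) ^ 2 + (2 * (64 * ((F.P K).d : ℝ) * cσ) + (64 * ((F.P K).d : ℝ) * cσ) ^ 2) *   ((((F.P K).d : ℝ) * (((F.P K).L : ℝ) - 1)) * (256 * (((F.P K).d : ℝ) + 1) * (((F.P K).d : ℝ) + 4) * (2 * ε₀) + cσ))) ^ 2)) := by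
    have hd : 0 ≤ (((F.P K).d : ℝ) * (((F.P K).L : ℝ) - 1)) := mul_nonneg (Nat.cast_nonneg _) (by
      have h2 := (F.P K).hL.2; have : (2 : ℝ) ≤ (F.P K).L := by exact_mod_cast h2
      linarith)
    positivity
  exact hStokes_of_rows_σ F x₀ hM' ha hroomW U cσ (by positivity) hR0 hb0 hρk1 (by linarith [hsmall]) hθb
    (fun gJ hInAk _ z ν => avgIter_mem_U1 _ (pull_toUField_mem (GaugeField.gaugeAct gJ U) 0) hε₀ hα3 hα2 (pdev_pull_lt hε₀ hInAk 0) le_rfl z ν)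
    (fun gJ hInAk hInAx z ν => comb_eq_dbar_mul_defect_inAx F hnK hε₀ hα3 hα2 hw1 hw2 hA U gJ hInAk hInAx z ν)
    (fun gJ hInAk hInAx => plaqSmall_avgIter_of_levels F hnK hε₀ hε7 hε₁ hε₁1 hR0 V U hU hV gJ hInAk hInAx hα3 hα2
      (comb_eq_dbar_mul_defect_levels_inAx F hnK hε₀ hα3 hα2 hw1 hw2 hA U gJ hInAk hInAx) hδw hRw hσw _ _)
    (hG_of_rows_σ F x₀ ha hroomW U hh0 hh1 hω0 hω1 hE0 hE1 hE hEk
      (fun gJ u₁ W A c₁ c' hInAk hInAx _ _ _ _ _ _ _ _ _ j hj w _ i => by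
        rw [if_pos hj]
        exact stairSizes_of_guards_inAx F hnK hε₀ hα3 hα2 hw1 hw2 hA hpw (by linarith [hhs64]) U gJ hInAk hInAx j hj (coverAt (F.P K) (j + 1) w) i)
      (fun gJ u₁ W A c₁ c' hInAk hInAx htow _ _ _ _ _ _ _ _ =>
        stairUnitary_of_guards_inAx_sq F hnK hε₀ hα3 hα2 hw1 hw2 hA a M' ρ' hs0 hsw hθw U gJ hInAk hInAx htow)
      (fun gJ u₁ W A c₁ c' h1 h2 h3 h4 h5 h6 h7 h8 h9 h10 h11 h12 j hj c hc r => by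
        rw [if_pos hj]
        exact omegaRow_of_guards_σ F hε₀ hα3 hα2 hαω hαω3 hαω4 hαωexp a M' ρ' s cσ U gJ u₁ W A c₁ c' h1 h2 h3 h4 h5 h6 h7 h8 h9 h10 h11 h12 j hj c hc r))

end Summit.QuantumFields.YangMills.Theorems.HalvingHStokesRow

end
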